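import Summits.BirchSwinnertonDyer.BirchSwinnertonDyer.Theorems.PrintCFramBottomClassIndexLawFiveLeAnchorReduction
import Summits.BirchSwinnertonDyer.Rank1Residual.X12.O11.RouteUMember11
import Summits.BirchSwinnertonDyer.Rank1Residual.Additive.QuadraticTwistBSDComparisonIsogeny
import HarnessLib

/-!
# Crux `PrintCFram.BottomClassIndexLawFiveLe` (stmt-BirchSwinnertonDyer-20372), line `relative-anchor-transfer`
# (sha16 72dde5b866033574), stub `stub_unitAnchor`: the two `p = 7` CLASS ANCHORS, explicitly, at the price
# the tree books them — `(7, −3375)` from cell `bsd-cm`'s Route U member `49a1^{(−11)}` modulo Route U's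
# displayed binders, `(7, 16581375)` from the same member through ONE `ℚ`-isogeny witness; and anchors in
# `BSD_p` currency move along isogenies (cell `bsd-print-cfram`, width seat `bsd-line-cfram-p1-w2`;
# THEOREMS ONLY, `--supports` 20372; nothing asserted, no stub closed; BSD is not proved by any of this)

HONEST FRAMING. Continuation of `PrintCFramBottomClassIndexLawFiveLeAnchorReduction.lean` (p606463): there
`stub_unitAnchor` ⟸ seven displayed anchors, one per leaf class `(p, j)`, and each anchor ⟸ one rank-one
`BSDp W₀ p` certificate (Cassels, modularity, GZK). Here the two `p = 7` classes are served IN THE KERNEL at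
exactly the price the tree already pays, and no more:

* §1 `bsdp_anchor_of_isIsogenous` — anchors in `BSD_p` currency MOVE ALONG `ℚ`-ISOGENIES (sibling cell's
  `Additive.TwistComparison.bsdp_of_bsdp_of_isIsogenous`: Cassels BY NAME + GZK + modularity; the analytic
  rank is an isogeny invariant unconditionally, `analyticRank_eq_of_isIsogenous'`). Hence the class
  `(7, 16581375)` (CM by `ℤ[√−7]`) costs one isogeny witness on top of the class `(7, −3375)`.
* §2 `anchor_seven_neg3375_of_routeU_D11` — the `(7, −3375)` anchor `∃ W₀, j(W₀) = −3375 ∧ r_an(W₀) = 1 ∧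
  S_open(W₀, 7)` from Route U's member theorem `RouteU.bsdp_seven_of_twist_cm7_D11_byClass` (BSD₇ for every
  globally minimal model of `49a1^{(−11)}` = `5929e1` with `r_an = 1`) composed with
  `RubinFormulaZpBsdp.ramifiedCMRubinFormulaAtZp_of_bsdp`. The binders are Route U's, VERBATIM (named facts
  Kriz–Li Thm 1.20 / Rem 3.10, Gross–Zagier, Kolyvagin, GZK, modularity, Burungale–Flach, Rubin 1983 Thm C,
  Buhler–Gross 1985; data: the Heegner field `ℚ(√−19)`, modular parametrisation and Heegner datum, a
  Heegner point, `r_an(W) = 1`, `L(W^{(−19)}, 1) ≠ 0`, the twin's minimal model with `7 ∤ u`, a Mordell–Weil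
  coordinate over `K`, `7 ∤ c_Manin`) plus Cassels for the `S_open` step. Nothing new is certified here.
* §3 `anchor_seven_16581375_of_routeU_D11_of_isIsogenous` — the `(7, 16581375)` anchor from the same member and
  a globally minimal `W₁` with `j(W₁) = 16581375` `ℚ`-isogenous to it (binder `hiso`; the `2`-isogeny
  `49a1^{(−11)} → 49a2^{(−11)}` is not constructed here).
What this file does NOT touch: the five classes `p ∈ {11, 19, 43, 67, 163}` (Gross's `A(p)`-classes), where a
rank-one `BSD_p` certificate AT THE RAMIFIED `p` is not in print (Li–Liu–Tian 2024 / Li–Tian–Yan–Zhu 2025: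
split `p`; Kobayashi 2013: good `p`; Rubin 1991 Thm 11.1: rank `0`) — there the anchor stub is an instance of
the crux. beyond-print theorem: NO.

References: [Miller2011LMS] Def. 1.1; [Cassels1965ArithmeticVIII]; [KrizLi2019] Thm 1.20, Rem 3.10;
[BuhlerGross1985] Ch. II; [Rubin1983] Thm C; [BurungaleFlach2024] Thm 1.1; [GrossZagier1986];
[BurungaleKobayashiNakamuraOta2026] arXiv:2608.06879 §1.4, Thm 7.2 (shape only).
-/

noncomputable section

-- summit-side namespace `Summit.BirchSwinnertonDyer.BirchSwinnertonDyer.…` (single-conjunct summit, D-0017 layout)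
set_option linter.dupNamespace false

open scoped Classical

open NumberField WeierstrassCurve DirichletCharacter
  Literature.NumberTheory.EllipticCurves Literature.NumberTheory.EllipticCurves.Rank1Residual
  Literature.NumberTheory.EllipticCurves.KrizLi2019 Literature.NumberTheory.LFunctions
  Literature.NumberTheory.EllipticCurves.ModularForms
  Summit.BirchSwinnertonDyer.Rank1Residual
  Summit.BirchSwinnertonDyer.Rank1Residual.X12.O11
  Summit.BirchSwinnertonDyer.BirchSwinnertonDyer.Theorems.RamifiedSevenEllipticUnits

namespace Summit.BirchSwinnertonDyer.BirchSwinnertonDyer.Theorems.PrintCFram.AnchorReduction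

/-! ## §1 Anchors in `BSD_p` currency move along `ℚ`-isogenies -/

/-- **A `BSD_p` anchor moves along a `ℚ`-isogeny.** Granted Cassels' isogeny invariance of the BSD quotient,
GZK and entire continuation: if a globally minimal elliptic `W₀` with `j(W₀) = j₀`, `r_an(W₀) = 1` and
`BSDp W₀ p` is `ℚ`-isogenous to a globally minimal elliptic `W₁` with `j(W₁) = j₁`, then `W₁` is an anchor of
class `j₁` in `BSD_p` currency: `r_an(W₁) = 1` (`analyticRank_eq_of_isIsogenous'`, unconditional) and
`BSDp W₁ p` (`TwistComparison.bsdp_of_bsdp_of_isIsogenous`). Used for `(7, −3375) ↝ (7, 16581375)`.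
[cite: Miller2011LMS, §1 and Def. 1.1 (arXiv:1010.2431 p. 3)] [cite: Cassels1965ArithmeticVIII] -/
theorem bsdp_anchor_of_isIsogenous (hCassels : bsdRHS_eq_of_isIsogenous)
    (hGZK : rank_eq_analyticRank_of_analyticRank_le_one) (hmod : hasEntireLFunction_rat) {p : ℕ} [Fact p.Prime]
    {j₁ : ℚ}
    {W₀ : WeierstrassCurve ℚ} [W₀.IsElliptic] [W₀.IsGloballyMinimal]
    (hr₀ : W₀.analyticRank = 1) (hB₀ : BSDp W₀ p)
    {W₁ : WeierstrassCurve ℚ} [W₁.IsElliptic] [W₁.IsGloballyMinimal]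
    (hiso : IsIsogenous W₀ W₁) (hj₁ : W₁.j = j₁) :
    ∃ (W : WeierstrassCurve ℚ) (_ : W.IsElliptic) (_ : W.IsGloballyMinimal),
      W.j = j₁ ∧ W.analyticRank = 1 ∧ BSDp W p :=
  ⟨W₁, ‹_›, ‹_›, hj₁, (analyticRank_eq_of_isIsogenous' hiso).symm.trans hr₀,
    Additive.TwistComparison.bsdp_of_bsdp_of_isIsogenous W₀ W₁ p hCassels hGZK hmod hiso hr₀.le hB₀⟩

/-! ## §2 The `(7, −3375)` anchor from Route U's member `49a1^{(−11)}`, at Route U's price -/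

/-- **The `(7, −3375)` anchor, explicitly, modulo Route U's displayed binders.** For a globally minimal model
`W` of `49a1^{(−11)}` (`5929e1`) with `r_an(W) = 1`, Route U's member theorem
`RouteU.bsdp_seven_of_twist_cm7_D11_byClass` (cell `bsd-cm`; binders verbatim: Kriz–Li Thm 1.20 / Rem 3.10,
Gross–Zagier, Kolyvagin, GZK, modularity, Burungale–Flach, Rubin 1983 Thm C, Buhler–Gross 1985 BY NAME; the
Heegner field `K = ℚ(√−19)` with its modular-parametrisation / Heegner data and a Heegner point, the
non-vanishing `L(W^{(−19)}, 1) ≠ 0`, the twin's minimal model with `7 ∤ u`, a Mordell–Weil coordinate over `K`,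
`7 ∤ c_Manin`) gives `BSDp W 7`; Cassels (`hCassels`) then gives the analytic ramified Rubin formula
`S_open(W, 7)` (`RubinFormulaZpBsdp.ramifiedCMRubinFormulaAtZp_of_bsdp`), and `j(W) = −3375`
(`RouteU.j_of_twist_cm7`). So `W` is the displayed anchor `h7a` of `stub_unitAnchor_of_anchors`. CONDITIONAL on
every displayed binder; nothing certified here. [cite: KrizLi2019, Thm. 1.20 and Rem. 3.10]
[cite: Miller2011LMS, Def. 1.1 (arXiv:1010.2431 p. 3)] [cite: Cassels1965ArithmeticVIII] -/
theorem anchor_seven_neg3375_of_routeU_D11 [Fact (Nat.Prime 7)] (hCassels : bsdRHS_eq_of_isIsogenous)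
    (hKL : KrizLi2019.thm120_padicLogHeegner_unit_of_bernoulli)
    (hRem : KrizLi2019.rem310_padicLogHeegner_integral)
    (W : WeierstrassCurve ℚ) [W.IsElliptic] [W.IsGloballyMinimal] [NeZero (W.conductorNorm ℤ)]
    (hW : ∃ C : VariableChange ℚ, C • W = cm7.quadraticTwist ((-(11 : ℕ) : ℤ) : ℚ))
    (K : Type) [Field K] [NumberField K] [NeZero (NumberField.discr K).natAbs]
    (hK : IsImaginaryQuadratic K) (hdK : NumberField.discr K = -(19 : ℕ))
    (D : ModularParametrizationData W (W.conductorNorm ℤ))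
    (H : HeegnerDatum (W.conductorNorm ℤ) (NumberField.discr K)) (ι : K →+* ℂ) (ιp : K →+* ℚ_[7])
    (P : (W.baseChange K).toAffine.Point)
    (hGZ : gross_zagier (W.conductorNorm ℤ) W K) (hKo : kolyvagin (W.conductorNorm ℤ) W K)
    (hGZK : rank_eq_analyticRank_of_analyticRank_le_one) (hmod : hasEntireLFunction_rat)
    (hP : WeierstrassCurve.Affine.Point.map ι.toRatAlgHom P = heegnerPointComplex D H)
    (hr1 : W.analyticRank = 1)
    (hLt : (W.quadraticTwist (NumberField.discr K : ℚ)).entireLFunction 1 ≠ 0)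
    (Wd : WeierstrassCurve ℚ) [Wd.IsElliptic] [Wd.IsGloballyMinimal] (Cd : VariableChange ℚ)
    (hWd : Cd • W.quadraticTwist (NumberField.discr K : ℚ) = Wd)
    (hBF : bsdTriple_of_hasCM_of_L_one_ne_zero)
    (hu : padicValRat 7 (Cd.u : ℚ) = 0)
    (hC : Rubin1983.thmC_seven_quadraticField)
    (hBG : BuhlerGross1985.firstDescent_seven_oddTwist_of_bernoulli)
    [Finite (AddCommGroup.torsion (W.baseChange K).toAffine.Point)]
    (crd : (W.baseChange K).toAffine.Point →+ ℤ) (g : (W.baseChange K).toAffine.Point)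
    (hg : crd g = 1) (hker : ∀ x, crd x = 0 → IsOfFinAddOrder x)
    (hc7 : ¬ ((7 : ℤ) ∣ D.c)) :
    ∃ (W₀ : WeierstrassCurve ℚ) (_ : W₀.IsElliptic) (_ : W₀.IsGloballyMinimal),
      W₀.j = -3375 ∧ W₀.analyticRank = 1 ∧ RamifiedCMRubinFormulaAtZp W₀ 7 := by
  have hB : BSDp W 7 :=
    RouteU.bsdp_seven_of_twist_cm7_D11_byClass hKL hRem W hW K hK hdK D H ι ιp P hGZ hKo hGZK hmod hP hr1
      hLt Wd Cd hWd hBF hu hC hBG crd g hg hker hc7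
  have hj : W.j = -3375 := RouteU.j_of_twist_cm7 W (D := -((11 : ℕ) : ℤ)) (by norm_num) hW
  exact ⟨W, ‹_›, ‹_›, hj, hr1,
    RubinFormulaZpBsdp.ramifiedCMRubinFormulaAtZp_of_bsdp hCassels hmod hGZK hr1.le hB⟩

/-! ## §3 The `(7, 16581375)` anchor from the same member and one isogeny witness -/

/-- **The `(7, 16581375)` anchor, modulo Route U's binders and ONE `ℚ`-isogeny witness.** With the binders of
`anchor_seven_neg3375_of_routeU_D11` for a globally minimal model `W` of `49a1^{(−11)}` and a globally minimal
elliptic `W₁` with `j(W₁) = 16581375` that is `ℚ`-isogenous to `W` (`hiso`; e.g. the minimal model of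
`49a2^{(−11)}` by the `2`-isogeny — not constructed here), `W₁` is the displayed anchor `h7b` of
`stub_unitAnchor_of_anchors`: `BSDp W 7` (Route U) moves to `W₁` by Cassels (§1), then `S_open(W₁, 7)` by
`RubinFormulaZpBsdp.ramifiedCMRubinFormulaAtZp_of_bsdp`. CONDITIONAL on every displayed binder.
[cite: Miller2011LMS, §1 and Def. 1.1 (arXiv:1010.2431 p. 3)] [cite: Cassels1965ArithmeticVIII]
[cite: KrizLi2019, Thm. 1.20 and Rem. 3.10] -/
theorem anchor_seven_16581375_of_routeU_D11_of_isIsogenous [Fact (Nat.Prime 7)]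
    (hCassels : bsdRHS_eq_of_isIsogenous)
    (hKL : KrizLi2019.thm120_padicLogHeegner_unit_of_bernoulli)
    (hRem : KrizLi2019.rem310_padicLogHeegner_integral)
    (W : WeierstrassCurve ℚ) [W.IsElliptic] [W.IsGloballyMinimal] [NeZero (W.conductorNorm ℤ)]
    (hW : ∃ C : VariableChange ℚ, C • W = cm7.quadraticTwist ((-(11 : ℕ) : ℤ) : ℚ))
    (K : Type) [Field K] [NumberField K] [NeZero (NumberField.discr K).natAbs]
    (hK : IsImaginaryQuadratic K) (hdK : NumberField.discr K = -(19 : ℕ))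
    (D : ModularParametrizationData W (W.conductorNorm ℤ))
    (H : HeegnerDatum (W.conductorNorm ℤ) (NumberField.discr K)) (ι : K →+* ℂ) (ιp : K →+* ℚ_[7])
    (P : (W.baseChange K).toAffine.Point)
    (hGZ : gross_zagier (W.conductorNorm ℤ) W K) (hKo : kolyvagin (W.conductorNorm ℤ) W K)
    (hGZK : rank_eq_analyticRank_of_analyticRank_le_one) (hmod : hasEntireLFunction_rat)
    (hP : WeierstrassCurve.Affine.Point.map ι.toRatAlgHom P = heegnerPointComplex D H)
    (hr1 : W.analyticRank = 1)
    (hLt : (W.quadraticTwist (NumberField.discr K : ℚ)).entireLFunction 1 ≠ 0)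
    (Wd : WeierstrassCurve ℚ) [Wd.IsElliptic] [Wd.IsGloballyMinimal] (Cd : VariableChange ℚ)
    (hWd : Cd • W.quadraticTwist (NumberField.discr K : ℚ) = Wd)
    (hBF : bsdTriple_of_hasCM_of_L_one_ne_zero)
    (hu : padicValRat 7 (Cd.u : ℚ) = 0)
    (hC : Rubin1983.thmC_seven_quadraticField)
    (hBG : BuhlerGross1985.firstDescent_seven_oddTwist_of_bernoulli)
    [Finite (AddCommGroup.torsion (W.baseChange K).toAffine.Point)]
    (crd : (W.baseChange K).toAffine.Point →+ ℤ) (g : (W.baseChange K).toAffine.Point)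
    (hg : crd g = 1) (hker : ∀ x, crd x = 0 → IsOfFinAddOrder x)
    (hc7 : ¬ ((7 : ℤ) ∣ D.c))
    (W₁ : WeierstrassCurve ℚ) [W₁.IsElliptic] [W₁.IsGloballyMinimal] (hiso : IsIsogenous W W₁)
    (hj₁ : W₁.j = 16581375) :
    ∃ (W₀ : WeierstrassCurve ℚ) (_ : W₀.IsElliptic) (_ : W₀.IsGloballyMinimal),
      W₀.j = 16581375 ∧ W₀.analyticRank = 1 ∧ RamifiedCMRubinFormulaAtZp W₀ 7 := by
  have hB : BSDp W 7 :=
    RouteU.bsdp_seven_of_twist_cm7_D11_byClass hKL hRem W hW K hK hdK D H ι ιp P hGZ hKo hGZK hmod hP hr1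
      hLt Wd Cd hWd hBF hu hC hBG crd g hg hker hc7
  obtain ⟨W₀, _, _, hj₀, hr₀, hB₀⟩ := bsdp_anchor_of_isIsogenous hCassels hGZK hmod hr1 hB hiso hj₁
  exact ⟨W₀, ‹_›, ‹_›, hj₀, hr₀,
    RubinFormulaZpBsdp.ramifiedCMRubinFormulaAtZp_of_bsdp hCassels hmod hGZK hr₀.le hB₀⟩

end Summit.BirchSwinnertonDyer.BirchSwinnertonDyer.Theorems.PrintCFram.AnchorReduction

end
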